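import Summits.QuantumAdvantage.QuantumAdvantage.Theorems.LinnikCubicClassGroupsDegreeOnePrimesEscapeClassPNTStark
import Summits.QuantumAdvantage.QuantumAdvantage.Theorems.LinnikCubicClassGroupsDegreeOnePrimesEscapeClassPNTFamilyDensity
import Summits.QuantumAdvantage.QuantumAdvantage.Theorems.LinnikCubicClassGroupsDegreeOnePrimesEscapeResidueBound
import Literature.NumberTheory.LFunctions.HeilbronnStark
import HarnessLib

/-!
# The additive class prime number theorem, XIII: cubic (and quartic) fields — the exceptional character
# is a genuine quadratic class group character; odd class number ⇒ NO exceptional term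

Topic `Summits/QuantumAdvantage/QuantumAdvantage/Theorems`, cell B2b-1 (linnik-cubic), PART A, the
`stub_classPNTAdditive` slice of the crux `DegreeOnePrimesEscape` (stmt-QuantumAdvantage-11543) of route
`LinnikCubicClassGroups`.  HONEST FRAMING: the value of this file is a THEOREM (kernel-checked, GRH-free,
Siegel-free, NO exceptional term under an algebraic hypothesis) — NOT summit progress.

For a number field `K` of degree `3` or `4` without quadratic subfield (automatic in degree `3`), Stark's
theorem excludes the trivial character from the exceptional alternative of the additive class prime number
theorem (`exceptionalChar_ne_one_of_noQuadraticSubfield`, file XII); a non-trivial real class group character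
has a kernel of index `2`, so `h_K` is even.  Hence:

* `classPNT_eps_of_noQuadraticSubfield_le_four` — degree `n ≤ 4`, no quadratic subfield, every `ε > 0`:
  `|π_C(x) − Li(x)/h| ≤ ε Li(x)/h` for all `C`, `x ≥ Q^{c₁}`, OR the exceptional alternative with a
  NON-TRIVIAL real character `χ₁`;
* `classPNT_eps_cubic` — the same for every cubic field;
* `classPNT_eps_cubic_of_odd_classNumber` — **for every `ε > 0` there is `c₁ > 0` such that for every cubic
  number field `K` with ODD class number, every ideal class `C` and every `x ≥ (27|d_K|)^{c₁}`:
  `|π_C(x) − Li(x)/h_K| ≤ ε · Li(x)/h_K`** — equidistribution of prime ideals among the ideal classes with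
  no exceptional term and no unproved hypothesis;
* `classPNT_eps_of_noQuadraticSubfield_le_four_of_odd_classNumber` — the same in degree `≤ 4` without
  quadratic subfield.
-/

noncomputable section

open Complex Real MeasureTheory Set Filter Topology
open scoped NumberField nonZeroDivisors

namespace Summit.QuantumAdvantage.QuantumAdvantage.Theorems.DegreeOnePrimesEscape

open Literature.NumberTheory.LFunctions Literature.NumberTheory.LFunctions.NumberField
  Literature.NumberTheory.LFunctions.AbelianDensity

/-- A non-trivial real class group character forces an even class number (its kernel has index `2`). -/
theorem even_classNumber_of_realChar_ne_one {K : Type} [Field K] [NumberField K]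
    {χ : ClassGroup (𝓞 K) →* ℂˣ} (hreal : χ * χ = 1) (hne : χ ≠ 1) : Even (NumberField.classNumber K) := by
  have hidx := Heilbronn.index_ker_eq_two_of_sign (classGroupChar_apply_eq_one_or_eq_neg_one hreal) hne
  have hdvd : χ.ker.index ∣ Nat.card (ClassGroup (𝓞 K)) := Subgroup.index_dvd_card _
  rw [hidx, Nat.card_eq_fintype_card] at hdvd
  exact even_iff_two_dvd.2 hdvd

/-- **Degree `n ≤ 4`, no quadratic subfield: the `ε`-dichotomy with a NON-TRIVIAL exceptional character.**
For `1 < n ≤ 4` and `ε > 0` there is `c₁ > 0` such that every number field `K` of degree `n` without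
quadratic subfield satisfies: `|π_C(x) − Li(x)/h| ≤ ε Li(x)/h` for all `C` and `x ≥ Q^{c₁}`, OR there are a
real class group character `χ₁ ≠ 1` and a real zero `β₁ ∈ (1 − 1/(8 log Q), 1)` of `L(s, χ₁)` with
`|π_C(x) − (Li(x) − Re χ₁(C) Li(x^{β₁}))/h| ≤ ε Li(x)/h` for all `C`, `x ≥ Q^{c₁}`. -/
theorem classPNT_eps_of_noQuadraticSubfield_le_four (n : ℕ) (hn : 1 < n) (hn4 : n ≤ 4) {ε : ℝ}
    (hε : 0 < ε) :
    ∃ c₁ : ℝ, 0 < c₁ ∧ ∀ (K : Type) [Field K] [NumberField K], Module.finrank ℚ K = n →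
      (∀ F : IntermediateField ℚ K, Module.finrank ℚ F ≠ 2) →
      ((∀ (C : ClassGroup (𝓞 K)) (x : ℝ), ThornerZaman.condQn K ^ c₁ ≤ x →
          |(primeIdealClassCount K C x : ℝ) - offsetLogIntegral x / NumberField.classNumber K| ≤
            ε * offsetLogIntegral x / NumberField.classNumber K) ∨
        ∃ (χ₁ : ClassGroup (𝓞 K) →* ℂˣ) (β₁ : ℝ), χ₁ * χ₁ = 1 ∧ χ₁ ≠ 1 ∧
          1 - 1 / (8 * Real.log (ThornerZaman.condQn K)) < β₁ ∧ β₁ < 1 ∧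
          classGroupLFunction K χ₁ β₁ = 0 ∧
          ∀ (C : ClassGroup (𝓞 K)) (x : ℝ), ThornerZaman.condQn K ^ c₁ ≤ x →
            |(primeIdealClassCount K C x : ℝ) -
                (offsetLogIntegral x - ((χ₁ C : ℂ)).re * offsetLogIntegral (x ^ β₁)) /
                  NumberField.classNumber K| ≤
              ε * offsetLogIntegral x / NumberField.classNumber K) := by
  obtain ⟨b, D, hb, hD, hdens⟩ := fam_density_local n hn 10
  have ha : (1 : ℝ) ≤ max 10 4 := le_trans (by norm_num) (le_max_right _ _)
  obtain ⟨c₁, c, hc₁, hc, hcn, h⟩ := classPNTAdditive_of_famDensity_eps_loc n hn hb hD ha hε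
  refine ⟨c₁, hc₁, fun K _ _ hKn hnq ↦ ?_⟩
  have hK : 1 < Module.finrank ℚ K := by rw [hKn]; exact hn
  have hκ := Residue.condQn_rpow_neg_ten_le_residue K hK hnq
  rcases h K hKn (hdens K hKn hκ) with h1 | ⟨χ₁, β₁, hreal, hβlow, hβQ, hβ1, hz, hbd⟩
  · exact Or.inl h1
  · refine Or.inr ⟨χ₁, β₁, hreal, ?_, hβQ, hβ1, hz, hbd⟩
    exact exceptionalChar_ne_one_of_noQuadraticSubfield hK (by rw [hKn]; exact hn4) hnq
      (by rw [hKn]; exact hcn) hβlow hβ1 hz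

/-- A cubic field has no quadratic subfield (tower law). -/
theorem noQuadraticSubfield_of_finrank_three {K : Type} [Field K] [NumberField K]
    (hK : Module.finrank ℚ K = 3) : ∀ F : IntermediateField ℚ K, Module.finrank ℚ F ≠ 2 := by
  intro F hF
  have hdvd : Module.finrank ℚ F ∣ Module.finrank ℚ K := Dvd.intro _ (Module.finrank_mul_finrank ℚ F K)
  rw [hF, hK] at hdvd
  omega

/-- **Every cubic field: the `ε`-dichotomy with a NON-TRIVIAL exceptional character** (`Q = 27|d_K|`). -/
theorem classPNT_eps_cubic {ε : ℝ} (hε : 0 < ε) :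
    ∃ c₁ : ℝ, 0 < c₁ ∧ ∀ (K : Type) [Field K] [NumberField K], Module.finrank ℚ K = 3 →
      ((∀ (C : ClassGroup (𝓞 K)) (x : ℝ), ThornerZaman.condQn K ^ c₁ ≤ x →
          |(primeIdealClassCount K C x : ℝ) - offsetLogIntegral x / NumberField.classNumber K| ≤
            ε * offsetLogIntegral x / NumberField.classNumber K) ∨
        ∃ (χ₁ : ClassGroup (𝓞 K) →* ℂˣ) (β₁ : ℝ), χ₁ * χ₁ = 1 ∧ χ₁ ≠ 1 ∧
          1 - 1 / (8 * Real.log (ThornerZaman.condQn K)) < β₁ ∧ β₁ < 1 ∧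
          classGroupLFunction K χ₁ β₁ = 0 ∧
          ∀ (C : ClassGroup (𝓞 K)) (x : ℝ), ThornerZaman.condQn K ^ c₁ ≤ x →
            |(primeIdealClassCount K C x : ℝ) -
                (offsetLogIntegral x - ((χ₁ C : ℂ)).re * offsetLogIntegral (x ^ β₁)) /
                  NumberField.classNumber K| ≤
              ε * offsetLogIntegral x / NumberField.classNumber K) := by
  obtain ⟨c₁, hc₁, h⟩ := classPNT_eps_of_noQuadraticSubfield_le_four 3 (by norm_num) (by norm_num) hε
  exact ⟨c₁, hc₁, fun K _ _ hK ↦ h K hK (noQuadraticSubfield_of_finrank_three hK)⟩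

/-- **Equidistribution of prime ideals among the ideal classes of a cubic field of ODD class number,
unconditionally and with no exceptional term**: for every `ε > 0` there is `c₁ > 0` such that for every
number field `K` of degree `3` with odd class number `h_K`, every ideal class `C` and every
`x ≥ (27|d_K|)^{c₁}`, `|π_C(x) − Li(x)/h_K| ≤ ε · Li(x)/h_K`. -/
theorem classPNT_eps_cubic_of_odd_classNumber {ε : ℝ} (hε : 0 < ε) :
    ∃ c₁ : ℝ, 0 < c₁ ∧ ∀ (K : Type) [Field K] [NumberField K], Module.finrank ℚ K = 3 →
      Odd (NumberField.classNumber K) →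
      ∀ (C : ClassGroup (𝓞 K)) (x : ℝ), ThornerZaman.condQn K ^ c₁ ≤ x →
        |(primeIdealClassCount K C x : ℝ) - offsetLogIntegral x / NumberField.classNumber K| ≤
          ε * offsetLogIntegral x / NumberField.classNumber K := by
  obtain ⟨c₁, hc₁, h⟩ := classPNT_eps_cubic hε
  refine ⟨c₁, hc₁, fun K _ _ hK hodd ↦ ?_⟩
  rcases h K hK with h1 | ⟨χ₁, β₁, hreal, hne, -, -, -, -⟩
  · exact h1
  · exact absurd (even_classNumber_of_realChar_ne_one hreal hne) (Nat.not_even_iff_odd.2 hodd)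

/-- **The same in degree `≤ 4` without quadratic subfield and odd class number.** -/
theorem classPNT_eps_of_noQuadraticSubfield_le_four_of_odd_classNumber (n : ℕ) (hn : 1 < n)
    (hn4 : n ≤ 4) {ε : ℝ} (hε : 0 < ε) :
    ∃ c₁ : ℝ, 0 < c₁ ∧ ∀ (K : Type) [Field K] [NumberField K], Module.finrank ℚ K = n →
      (∀ F : IntermediateField ℚ K, Module.finrank ℚ F ≠ 2) → Odd (NumberField.classNumber K) →
      ∀ (C : ClassGroup (𝓞 K)) (x : ℝ), ThornerZaman.condQn K ^ c₁ ≤ x →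
        |(primeIdealClassCount K C x : ℝ) - offsetLogIntegral x / NumberField.classNumber K| ≤
          ε * offsetLogIntegral x / NumberField.classNumber K := by
  obtain ⟨c₁, hc₁, h⟩ := classPNT_eps_of_noQuadraticSubfield_le_four n hn hn4 hε
  refine ⟨c₁, hc₁, fun K _ _ hK hnq hodd ↦ ?_⟩
  rcases h K hK hnq with h1 | ⟨χ₁, β₁, hreal, hne, -, -, -, -⟩
  · exact h1
  · exact absurd (even_classNumber_of_realChar_ne_one hreal hne) (Nat.not_even_iff_odd.2 hodd)

end Summit.QuantumAdvantage.QuantumAdvantage.Theorems.DegreeOnePrimesEscape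

end
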